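import Literature.NumberTheory.EllipticCurves.NewformSymmSquareJ1728Hecke
import Literature.NumberTheory.EllipticCurves.NewformSymmSquareTwistClass
import Literature.NumberTheory.EllipticCurves.ComplexMultiplicationHasCMIffHoldsProofs
import HarnessLib

/-!
# Murty's bound `(f, f) ≫ N^{1−ε}`: the CM side reduced to the single family `j = 0`

Topic `NumberTheory/EllipticCurves`; namespace `Literature.NumberTheory.EllipticCurves.ModularForms`.
A proofs-only file (theorems only; no definition, no named fact, D-0026), in support of the named fact
`murty_petersson_newform_lower_bound` (`NewformPeterssonSize`; Murty 1999, §2 (3) ⇐ Hoffstein–Lockhart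
1994, Thm. 0.1). The tree reduces the fact (`murty_petersson_newform_lower_bound_of_pairData_nonCM`,
`NewformPeterssonSizePairReductionProofs`) to (A) `GL₃ × GL₃` pair data for the non-CM,
non-twist-equivalent pairs of elliptic newforms, and (B) a direct bound
`hCM : ∀ ε > 0 ∃ c > 0, c N^{−ε} ≤ symmSqLOne f` on the CM newforms. With

* `exists_symmSqLOne_ge_of_j_eq_1728` (`NewformSymmSquareJ1728Hecke`: the family `j = 1728`, via Hecke
  `L`-functions of `ℚ(i)`),
* `exists_symmSqLOne_ge_of_j_mem_cmJInvariants` (`NewformSymmSquareTwistClass`: each of the eleven CM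
  `j`-invariants `≠ 0, 1728`, a single quadratic-twist class each), and
* `j_mem_cmJInvariants_of_hasCM_holds` (`ComplexMultiplicationHasCMIffHoldsProofs`: a CM curve over `ℚ`
  has one of the thirteen `j`-invariants `WeierstrassCurve.cmJInvariants`; Silverman App. C §11 with
  the class number one theorem),

(B) is PROVED for every CM newform with `j ≠ 0` (`exists_symmSqLOne_ge_of_hasCM_of_j_ne_zero`), and the
fact is reduced to (A) plus the bound on the single family `j = 0` (the curves `y² = x³ + k`, CM by
`ℤ[ζ₃]`, whose symmetric squares factor through Hecke `L`-functions of `ℚ(√−3)` not yet in the tree):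
`murty_petersson_newform_lower_bound_of_pairData_nonCM_of_j_zero`.

## References

* J. Hoffstein, P. Lockhart, *Coefficients of Maass forms and the Siegel zero*, Ann. of Math. 140
  (1994), 161–181, Thm. 0.1. [cite: HoffsteinLockhart1994, Thm. 0.1]
* M. R. Murty, *Bounds for congruence primes*, Proc. Sympos. Pure Math. 66.1 (1999), §2, (3).
  [cite: MurtyCongruencePrimes1999, §2 (3)]
* J. H. Silverman, *The Arithmetic of Elliptic Curves*, 2nd ed. (2009), App. C §11.
  [cite: SilvermanAEC2009, App. C §11 Example 11.3.1]

## Mathlib / tree search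

Tree: `murty_petersson_newform_lower_bound_of_pairData_nonCM`, `EllipticNewformIndex`, `TwistEquiv`,
`symmSqL`, `symmSqLOne` (`NewformPeterssonSizePairReductionProofs` and imports);
`exists_symmSqLOne_ge_of_j_eq_1728`, `exists_symmSqL_one_re_ge_of_j_eq_1728` (`NewformSymmSquareJ1728Hecke`);
`exists_symmSqLOne_ge_of_j_mem_cmJInvariants`, `exists_symmSqL_one_re_ge_of_j_mem_cmJInvariants`
(`NewformSymmSquareTwistClass`); `j_mem_cmJInvariants_of_hasCM_holds`
(`ComplexMultiplicationHasCMIffHoldsProofs`); `WeierstrassCurve.HasCM`, `WeierstrassCurve.cmJInvariants`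
(`Isogeny`).
-/

noncomputable section

open scoped Real Topology ComplexOrder
open Set Filter Metric Complex CongruenceSubgroup
open Literature.NumberTheory.LFunctions

namespace Literature.NumberTheory.EllipticCurves.ModularForms

open _root_.WeierstrassCurve

/-! ### The CM newforms with `j ≠ 0` -/

/-- **`Re L_f(1) ≫_δ N^{−δ}` on the elliptic newforms with a CM `j`-invariant `≠ 0`**: the family
`j = 1728` (`exists_symmSqL_one_re_ge_of_j_eq_1728`) together with the eleven twist classes
`j ∈ cmJInvariants ∖ {0, 1728}` (`exists_symmSqL_one_re_ge_of_j_mem_cmJInvariants`).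
[cite: HoffsteinLockhart1994, Thm. 0.1 (the CM and twist-equivalent cases)] -/
theorem exists_symmSqL_one_re_ge_of_j_mem_cmJInvariants_of_ne_zero {δ : ℝ} (hδ : 0 < δ) :
    ∃ c : ℝ, 0 < c ∧ ∀ i : EllipticNewformIndex, i.W.j ∈ cmJInvariants → i.W.j ≠ 0 →
      c * (i.N : ℝ) ^ (-δ) ≤ (symmSqL i.N i.f 1).re := by
  obtain ⟨c₁, hc₁, h₁⟩ := exists_symmSqL_one_re_ge_of_j_eq_1728 hδ
  obtain ⟨c₂, hc₂, h₂⟩ := exists_symmSqL_one_re_ge_of_j_mem_cmJInvariants hδ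
  refine ⟨min c₁ c₂, lt_min hc₁ hc₂, fun i hi h0 ↦ ?_⟩
  have hN : (0 : ℝ) ≤ (i.N : ℝ) ^ (-δ) := Real.rpow_nonneg (Nat.cast_nonneg _) _
  by_cases h1728 : i.W.j = 1728
  · exact (mul_le_mul_of_nonneg_right (min_le_left _ _) hN).trans (h₁ i.N i.W i.f i.isNewformOf h1728)
  · exact (mul_le_mul_of_nonneg_right (min_le_right _ _) hN).trans (h₂ i hi h0 h1728)

/-- The same for `symmSqLOne` (the shape of `hCM`). [cite: HoffsteinLockhart1994, Thm. 0.1 (the CM and twist-equivalent cases)] -/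
theorem exists_symmSqLOne_ge_of_j_mem_cmJInvariants_of_ne_zero {δ : ℝ} (hδ : 0 < δ) :
    ∃ c : ℝ, 0 < c ∧ ∀ i : EllipticNewformIndex, i.W.j ∈ cmJInvariants → i.W.j ≠ 0 →
      c * (i.N : ℝ) ^ (-δ) ≤ symmSqLOne i.f := by
  obtain ⟨c, hc, h⟩ := exists_symmSqL_one_re_ge_of_j_mem_cmJInvariants_of_ne_zero hδ
  exact ⟨c, hc, fun i hi h0 ↦ (h i hi h0).trans (symmSqL_one_re_le_symmSqLOne i.f)⟩

/-- **`hCM` for every CM elliptic newform with `j ≠ 0`**: a curve over `ℚ` with complex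
multiplication has one of the thirteen CM `j`-invariants (`j_mem_cmJInvariants_of_hasCM_holds`,
Silverman App. C §11 with the class number one theorem), and the twelve invariants `≠ 0` are covered by
`exists_symmSqLOne_ge_of_j_mem_cmJInvariants_of_ne_zero`. [cite: HoffsteinLockhart1994, Thm. 0.1 (the CM case)]
[cite: SilvermanAEC2009, App. C §11 Example 11.3.1] -/
theorem exists_symmSqLOne_ge_of_hasCM_of_j_ne_zero {δ : ℝ} (hδ : 0 < δ) :
    ∃ c : ℝ, 0 < c ∧ ∀ i : EllipticNewformIndex, i.W.HasCM → i.W.j ≠ 0 →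
      c * (i.N : ℝ) ^ (-δ) ≤ symmSqLOne i.f := by
  obtain ⟨c, hc, h⟩ := exists_symmSqLOne_ge_of_j_mem_cmJInvariants_of_ne_zero hδ
  exact ⟨c, hc, fun i hCM h0 ↦ h i (j_mem_cmJInvariants_of_hasCM_holds i.W hCM) h0⟩

/-- Murty's Petersson form on the CM newforms with `j ≠ 0`: `c N^{1−ε} ≤ Re (f, f)` — the statement
of `murty_petersson_newform_lower_bound` on that family. [cite: MurtyCongruencePrimes1999, §2 (3)]
[cite: HoffsteinLockhart1994, Thm. 0.1] -/
theorem exists_petersson_ge_of_hasCM_of_j_ne_zero {ε : ℝ} (hε : 0 < ε) :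
    ∃ c : ℝ, 0 < c ∧ ∀ (N : ℕ) [NeZero N] (W : WeierstrassCurve ℚ) [W.IsElliptic]
      (f : CuspForm (Gamma0 N) 2), IsNewformOf W f → W.HasCM → W.j ≠ 0 →
        c * (N : ℝ) ^ (1 - ε) ≤ (peterssonProduct (Gamma0 N) 2 f f).re := by
  obtain ⟨c, hc, h⟩ := exists_symmSqL_one_re_ge_of_j_mem_cmJInvariants_of_ne_zero hε
  refine ⟨c / (8 * π ^ 3), by positivity, fun N _ W _ f hf hCM hj ↦ ?_⟩
  have hN0 : N ≠ 0 := NeZero.ne N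
  have hN : (0 : ℝ) < N := by exact_mod_cast Nat.pos_of_ne_zero hN0
  have hidx : (N : ℝ) ≤ gamma0Index N := by exact_mod_cast le_gamma0Index hN0
  have hidx0 : (0 : ℝ) < gamma0Index N := by exact_mod_cast gamma0Index_pos N
  have hV := re_peterssonProduct_self_nonneg f
  have key := h ⟨N, W, f, hf⟩ (j_mem_cmJInvariants_of_hasCM_holds W hCM) hj
  simp only [] at key
  rw [symmSqL_one, Complex.ofReal_re] at key
  have h1 : c * (N : ℝ) ^ (-ε) ≤ 8 * π ^ 3 * (peterssonProduct (Gamma0 N) 2 f f).re / N :=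
    key.trans (div_le_div_of_nonneg_left (by positivity) hN hidx)
  rw [le_div_iff₀ hN] at h1
  have hsplit : (N : ℝ) ^ (1 - ε) = (N : ℝ) ^ (-ε) * N := by
    rw [show (1 : ℝ) - ε = -ε + 1 by ring, Real.rpow_add hN, Real.rpow_one]
  rw [hsplit, div_mul_eq_mul_div, div_le_iff₀ (by positivity)]
  nlinarith [h1]

/-! ### The fact from the `GL₃` pair data and the family `j = 0` alone -/

/-- **Murty's bound from the `GL₃` pair data for the non-CM, non-twist-equivalent pairs plus the single
CM family `j = 0`.** As `murty_petersson_newform_lower_bound_of_pairData_nonCM` with `CM = HasCM`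
(geometric complex multiplication, `WeierstrassCurve.HasCM`), where the hypothesis `hCM` is now only
required on the newforms of the curves with `j = 0` (`y² = x³ + k`, CM by `ℤ[ζ₃]`): the other twelve CM
`j`-invariants are theorems (`exists_symmSqLOne_ge_of_hasCM_of_j_ne_zero`). The remaining inputs are the
`GL₃ × GL₃` Rankin–Selberg data `P i j` (model `L(s, Sym² f_i × Sym² f_j)`) of Hoffstein–Lockhart §1
for non-CM `f_i, f_j` that are not twist-equivalent, and `L(1, Sym² f) ≫ N^{−ε}` on the family `j = 0`
(Hecke `L`-functions of `ℚ(√−3)`). [cite: HoffsteinLockhart1994, Thm. 0.1] [cite: MurtyCongruencePrimes1999, §2 (3)] -/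
theorem murty_petersson_newform_lower_bound_of_pairData_nonCM_of_j_zero
    (hCM0 : ∀ ε : ℝ, 0 < ε → ∃ c : ℝ, 0 < c ∧ ∀ j : EllipticNewformIndex, j.W.j = 0 →
      c * (j.N : ℝ) ^ (-ε) ≤ symmSqLOne j.f)
    (P : EllipticNewformIndex → EllipticNewformIndex → ℂ → ℂ)
    (hPd : ∀ i j, ¬ i.W.HasCM → ¬ j.W.HasCM → ¬ TwistEquiv i j →
      DifferentiableOn ℂ (P i j) (ball (2 : ℂ) (3 / 2)))
    {B₂ κ₂ : ℝ} (hB₂ : 0 ≤ B₂) (hκ₂ : 0 ≤ κ₂)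
    (hPle : ∀ i j, ¬ i.W.HasCM → ¬ j.W.HasCM → ¬ TwistEquiv i j → ∀ s ∈ closedBall (2 : ℂ) (3 / 2),
      ‖P i j s‖ ≤ B₂ * ((i.N : ℝ) * j.N) ^ κ₂)
    (hcoeff₃ : ∀ i j, ¬ i.W.HasCM → ¬ j.W.HasCM → ¬ TwistEquiv i j → ∃ a : ℕ → ℂ, 0 ≤ a ∧ a 1 = 1 ∧
      (∀ s : ℂ, 1 < s.re → LSeriesSummable a s) ∧
      ∀ s : ℂ, 1 < s.re →
        riemannZeta₁ s * (symmSqL i.N i.f s * symmSqL j.N j.f s * P i j s) = (s - 1) * LSeries a s)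
    (hP1 : ∀ δ : ℝ, 0 < δ → ∃ T : ℝ, ∀ i j, ¬ i.W.HasCM → ¬ j.W.HasCM → ¬ TwistEquiv i j →
      ‖P i j 1‖ ≤ T * ((i.N : ℝ) * j.N) ^ δ) :
    murty_petersson_newform_lower_bound := by
  refine murty_petersson_newform_lower_bound_of_pairData_nonCM (fun i ↦ i.W.HasCM) (fun ε hε ↦ ?_)
    P hPd hB₂ hκ₂ hPle hcoeff₃ hP1
  obtain ⟨c₁, hc₁, h₁⟩ := hCM0 ε hε
  obtain ⟨c₂, hc₂, h₂⟩ := exists_symmSqLOne_ge_of_hasCM_of_j_ne_zero hε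
  refine ⟨min c₁ c₂, lt_min hc₁ hc₂, fun j hj ↦ ?_⟩
  have hN : (0 : ℝ) ≤ (j.N : ℝ) ^ (-ε) := Real.rpow_nonneg (Nat.cast_nonneg _) _
  by_cases h0 : j.W.j = 0
  · exact (mul_le_mul_of_nonneg_right (min_le_left _ _) hN).trans (h₁ j h0)
  · exact (mul_le_mul_of_nonneg_right (min_le_right _ _) hN).trans (h₂ j hj h0)

/-- The same with the CM predicate "`j ∈ cmJInvariants`" in place of `HasCM` (no input from the class
number one theorem; the pair data are then required off the thirteen CM `j`-invariants).
[cite: HoffsteinLockhart1994, Thm. 0.1] [cite: MurtyCongruencePrimes1999, §2 (3)] -/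
theorem murty_petersson_newform_lower_bound_of_pairData_cmJ_of_j_zero
    (hCM0 : ∀ ε : ℝ, 0 < ε → ∃ c : ℝ, 0 < c ∧ ∀ j : EllipticNewformIndex, j.W.j = 0 →
      c * (j.N : ℝ) ^ (-ε) ≤ symmSqLOne j.f)
    (P : EllipticNewformIndex → EllipticNewformIndex → ℂ → ℂ)
    (hPd : ∀ i j, i.W.j ∉ cmJInvariants → j.W.j ∉ cmJInvariants → ¬ TwistEquiv i j →
      DifferentiableOn ℂ (P i j) (ball (2 : ℂ) (3 / 2)))
    {B₂ κ₂ : ℝ} (hB₂ : 0 ≤ B₂) (hκ₂ : 0 ≤ κ₂)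
    (hPle : ∀ i j, i.W.j ∉ cmJInvariants → j.W.j ∉ cmJInvariants → ¬ TwistEquiv i j →
      ∀ s ∈ closedBall (2 : ℂ) (3 / 2), ‖P i j s‖ ≤ B₂ * ((i.N : ℝ) * j.N) ^ κ₂)
    (hcoeff₃ : ∀ i j, i.W.j ∉ cmJInvariants → j.W.j ∉ cmJInvariants → ¬ TwistEquiv i j →
      ∃ a : ℕ → ℂ, 0 ≤ a ∧ a 1 = 1 ∧ (∀ s : ℂ, 1 < s.re → LSeriesSummable a s) ∧
      ∀ s : ℂ, 1 < s.re →
        riemannZeta₁ s * (symmSqL i.N i.f s * symmSqL j.N j.f s * P i j s) = (s - 1) * LSeries a s)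
    (hP1 : ∀ δ : ℝ, 0 < δ → ∃ T : ℝ, ∀ i j, i.W.j ∉ cmJInvariants → j.W.j ∉ cmJInvariants →
      ¬ TwistEquiv i j → ‖P i j 1‖ ≤ T * ((i.N : ℝ) * j.N) ^ δ) :
    murty_petersson_newform_lower_bound := by
  refine murty_petersson_newform_lower_bound_of_pairData_nonCM (fun i ↦ i.W.j ∈ cmJInvariants)
    (fun ε hε ↦ ?_) P (fun i j hi hj ↦ hPd i j hi hj) hB₂ hκ₂ (fun i j hi hj ↦ hPle i j hi hj)
    (fun i j hi hj ↦ hcoeff₃ i j hi hj) (fun δ hδ ↦ ?_)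
  · obtain ⟨c₁, hc₁, h₁⟩ := hCM0 ε hε
    obtain ⟨c₂, hc₂, h₂⟩ := exists_symmSqLOne_ge_of_j_mem_cmJInvariants_of_ne_zero hε
    refine ⟨min c₁ c₂, lt_min hc₁ hc₂, fun j hj ↦ ?_⟩
    have hN : (0 : ℝ) ≤ (j.N : ℝ) ^ (-ε) := Real.rpow_nonneg (Nat.cast_nonneg _) _
    by_cases h0 : j.W.j = 0
    · exact (mul_le_mul_of_nonneg_right (min_le_left _ _) hN).trans (h₁ j h0)
    · exact (mul_le_mul_of_nonneg_right (min_le_right _ _) hN).trans (h₂ j hj h0)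
  · obtain ⟨T, hT⟩ := hP1 δ hδ
    exact ⟨T, fun i j hi hj ↦ hT i j hi hj⟩

end Literature.NumberTheory.EllipticCurves.ModularForms

end
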